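import Literature.Algebra.Lie.LefschetzModuleKleimanAlgebraComparison
import Literature.AlgebraicGeometry.Motives.HodgeStructureExteriorAlgebraKleimanAlgebra
import Literature.AlgebraicGeometry.Motives.HodgeStructureExteriorPowerPrimitiveIsotropicSpan
import HarnessLib

/-!
# `K[e_ω, ᶜΛ] ≅ ⊕_{k=0}^{g} M_{k+1}(K)` on the exterior algebra of a symplectic space of genus `g`
# (André 1996, Prop. 1.2, second assertion and the Remark after it, read on `⋀ W`)

[topic AlgebraicGeometry/Motives]

Layer `Literature/AlgebraicGeometry/Motives`, lane `lit-hodgefound` (Track 2 foundations library; prover seat `lit-hodgefound-p34`,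
generation 30, row g30-#8).  The READING of rows g30-#5 (`Algebra/Lie/LefschetzModuleKleimanAlgebraMatrix.lean`: André's
`Φ = matrixHom`, `matrixEquiv : (Π_{k ∈ stringTypes} M_{k+1}(K)) ≃ₐ K[e, ᶜΛ]`, `dim K[e, ᶜΛ] = Σ (k+1)²`) and g30-#7
(`LefschetzModuleKleimanAlgebraComparison.lean`: the matrices of `h`, `ᶜΛ`, `*_L`, `*_H`; André's comparison isomorphism) on the
Lefschetz module `(⋀ W, h, e_ω)` of a non-degenerate 2-vector `ω` of genus `g` (rows g29-#1/#4, g30-#2: `e_ω = LinearMap.mul _ _ ω`,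
`ᶜΛ = lefschetzDual ω g`, `*_L = lefschetzStar ω g`, `∗ = hodgeStar ω g`).  On `⋀ W` EVERY string length `k + 1`, `0 ≤ k ≤ g`, occurs
(`P^{g-k} ∋ e₁ ∧ ⋯ ∧ e_{g-k} ≠ 0` for a Darboux basis — row g23-#1 `ιMulti_inl_castLE_mem_primitive`), so the index set of André's sum is
`{0, …, g}` and `dim K[e_ω, ᶜΛ] = Σ_{k=0}^{g} (k+1)² = (g+1)(g+2)(2g+3)/6`.  DEFINITIONS WITH BODIES (`IsSymplectic.matrixEquiv`,
`IsSymplectic.kleimanAlgebraCongr`) and PROVED theorems only (no named fact, no `sorry`, no instance, no notation; net debt `0`).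

## Source, VERBATIM

Y. André, *Pour une théorie inconditionnelle des motifs*, Publ. Math. IHÉS **83** (1996) [Andre1996Motifs] (held
`paper:doi-10-1007-bf02698643`), Prop. 1.2 (p. 11): "De plus, ces algèbres sont canoniquement isomorphes à une somme d'algèbres
matricielles `M_{i+1}(ℚ)` indexée par les entiers `i` tels que `P^{d-i}(X) ≠ 0`."; Remark (p. 12): "Si `H'` est une autre théorie de
cohomologie […] ayant les mêmes nombres de Betti que `H` […] on a un triangle commutatif d'isomorphismes […] où la flèche verticale est
donnée par `L ↦ L'`, `*_L ↦ *_{L'}`".  J. S. Milne, *Lefschetz classes on abelian varieties* [Milne1999LefschetzClasses], §5 p. 664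
(`H*(A) = ⋀ H¹(A)` for an abelian variety; `L`, `Λ`, `ᶜΛ`, `∗`).

## Contents (all proved unless marked def; `E = ExteriorAlgebra K W`, `hω : IsSymplectic ω g`)

* §1 every length occurs: **`IsSymplectic.primitiveSpace_ne_bot`** (`P_{-k} ≠ 0` for `k ≤ g`), `IsSymplectic.mem_stringTypes_iff`,
  **`IsSymplectic.stringTypes_eq`** (`= {0, …, g}`).
* §2 dimension: **`IsSymplectic.finrank_adjoin_lefschetzDual`** (`dim K[e_ω, ᶜΛ] = Σ_{k ≤ g} (k+1)²`), `six_mul_sum_range_succ_sq`,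
  `IsSymplectic.six_mul_finrank_adjoin_lefschetzDual` (`= (g+1)(g+2)(2g+3)/6`), `IsSymplectic.finrank_adjoin_lefschetzStar` (`K[e_ω, *_L]`),
  `IsSymplectic.finrank_adjoin_hodgeStar` (`K[e_ω, ∗]`).
* §3 (def) **`IsSymplectic.matrixEquiv`** (`(Π_{k ≤ g} M_{k+1}(K)) ≃ₐ[K] K[e_ω, ᶜΛ]`), `IsSymplectic.coe_matrixEquiv_apply`,
  `IsSymplectic.matrixEquiv_symm_apply_eq`, and the matrices: `IsSymplectic.coe_matrixEquiv_subdiag` (`= e_ω`), `…_superdiag`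
  (`= *_L e_ω *_L`, Milne's `Λ`), `…_antidiag` (`= *_L`), `…_antidiag_smul` (`= ∗`), `…_dualMatrix` (`= ᶜΛ`), `…_diag` (`= h`).
* §4 (def) **`IsSymplectic.kleimanAlgebraCongr`** (two symplectic spaces of the same genus, possibly over different vector spaces:
  `K[e_ω, ᶜΛ] ≃ₐ[K] K[e_ω', ᶜΛ']`), **`IsSymplectic.coe_kleimanAlgebraCongr_mul`** (`e_ω ↦ e_ω'`), `…_lefschetzStar` (`*_L ↦ *_L'`),
  `…_hodgeStar`, `…_lefschetzDual`, `…_shiftedDegree`.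

## References

* [Andre1996Motifs] Y. André, *Pour une théorie inconditionnelle des motifs*, Publ. Math. IHÉS 83 (1996) 5–49, Prop. 1.2 and the Remark
  after it (pp. 11–12).
* [Milne1999LefschetzClasses] J. S. Milne, *Lefschetz classes on abelian varieties*, Duke Math. J. 96 (1999), §5 p. 664.
* [GoodmanWallachGTM255] R. Goodman, N. Wallach, *Symmetry, Representations, and Invariants*, §5.5.2 (primitive = harmonic `p`-vectors).
-/

noncomputable section

universe u v v'

namespace Literature.AlgebraicGeometry.Motives.ExteriorLefschetz

open Literature.Algebra.Lie ExteriorAlgebra Module Function Set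
open Literature.Algebra.Lie.HasLefschetzProperty (primitiveSpace mem_primitiveSpace_iff stringTypes matrixFamilyCongr)

variable {K : Type u} [Field K] [CharZero K] {W : Type v} [AddCommGroup W] [Module K W]
variable {ω : ExteriorAlgebra K W} {g : ℕ}

/-! ## §1 On `⋀ W` every string length `k + 1`, `k ≤ g`, occurs -/

/-- **`P_{-k} ≠ 0` for `k ≤ g`**: `e₁ ∧ ⋯ ∧ e_{g-k}` (Darboux basis) is a non-zero primitive `(g-k)`-vector.
[cite: Andre1996Motifs, Prop. 1.2 (p. 11, "les entiers i tels que P^{d-i}(X) ≠ 0")] [cite: GoodmanWallachGTM255, §5.5.2 Thm. 5.5.15 (proof)] -/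
theorem IsSymplectic.primitiveSpace_ne_bot (hω : IsSymplectic ω g) {k : ℕ} (hk : k ≤ g) :
    primitiveSpace (shiftedDegree K (fun i : ℕ ↦ ⋀[K]^i W) g) (LinearMap.mul K (ExteriorAlgebra K W) ω) k ≠ ⊥ := by
  obtain ⟨c, rfl⟩ := hω
  rw [primitiveSpace_shiftedDegree_mul_eq_primitive _ g hk]
  intro hbot
  have h1 := ιMulti_inl_castLE_mem_primitive c (p := g - k) (by omega)
  rw [hbot, Submodule.mem_bot] at h1
  exact ιMulti_inl_castLE_ne_zero c (by omega) h1

/-- **The occurring string lengths of `(⋀ W, e_ω)` are exactly `k + 1`, `0 ≤ k ≤ g`.** [cite: Andre1996Motifs, Prop. 1.2 (p. 11)] -/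
theorem IsSymplectic.mem_stringTypes_iff (hω : IsSymplectic ω g) {k : ℕ} :
    k ∈ stringTypes (shiftedDegree K (fun i : ℕ ↦ ⋀[K]^i W) g) (LinearMap.mul K (ExteriorAlgebra K W) ω) ↔ k ≤ g := by
  haveI := hω.finiteDimensional_exteriorAlgebra
  rw [hω.hasLefschetzProperty_mul.mem_stringTypes_iff]
  refine ⟨fun h ↦ ?_, fun h ↦ hω.primitiveSpace_ne_bot h⟩
  by_contra hlt
  exact h (primitiveSpace_shiftedDegree_mul_eq_bot ω g (not_le.1 hlt))

/-- **`stringTypes = {0, …, g}`** — André's index set "les entiers `i` tels que `P^{d-i} ≠ 0`" on `⋀ W` is all of `0 ≤ i ≤ g`.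
[cite: Andre1996Motifs, Prop. 1.2 (p. 11)] -/
theorem IsSymplectic.stringTypes_eq (hω : IsSymplectic ω g) :
    stringTypes (shiftedDegree K (fun i : ℕ ↦ ⋀[K]^i W) g) (LinearMap.mul K (ExteriorAlgebra K W) ω) = Finset.range (g + 1) := by
  ext k
  rw [hω.mem_stringTypes_iff, Finset.mem_range, Nat.lt_succ_iff]

/-! ## §2 `dim K[e_ω, ᶜΛ] = Σ_{k=0}^{g} (k+1)² = (g+1)(g+2)(2g+3)/6` -/

/-- **`dim_K K[e_ω, ᶜΛ] = Σ_{k=0}^{g} (k + 1)²`.** [cite: Andre1996Motifs, Prop. 1.2 (p. 11)] -/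
theorem IsSymplectic.finrank_adjoin_lefschetzDual (hω : IsSymplectic ω g) (hg : 0 < g) :
    finrank K ↥(Algebra.adjoin K
      ({LinearMap.mul K (ExteriorAlgebra K W) ω, lefschetzDual ω g} : Set (Module.End K (ExteriorAlgebra K W)))) =
      ∑ k ∈ Finset.range (g + 1), (k + 1) ^ 2 := by
  haveI := hω.finiteDimensional_exteriorAlgebra
  rw [← hω.dual_eq_lefschetzDual hg,
    hω.hasLefschetzProperty_mul.finrank_adjoin_pair_dual (isZGrading_shiftedDegree K (fun i : ℕ ↦ ⋀[K]^i W) g), hω.stringTypes_eq]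

/-- `6 Σ_{k=0}^{g} (k+1)² = (g+1)(g+2)(2g+3)`. [folklore] -/
private theorem six_mul_sum_range_succ_sq (g : ℕ) :
    6 * ∑ k ∈ Finset.range (g + 1), (k + 1) ^ 2 = (g + 1) * (g + 2) * (2 * g + 3) := by
  induction g with
  | zero => simp
  | succ g ih => rw [Finset.sum_range_succ, mul_add, ih]; ring

/-- **`6 · dim K[e_ω, ᶜΛ] = (g+1)(g+2)(2g+3)`.** [cite: Andre1996Motifs, Prop. 1.2 (p. 11)] -/
theorem IsSymplectic.six_mul_finrank_adjoin_lefschetzDual (hω : IsSymplectic ω g) (hg : 0 < g) :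
    6 * finrank K ↥(Algebra.adjoin K
      ({LinearMap.mul K (ExteriorAlgebra K W) ω, lefschetzDual ω g} : Set (Module.End K (ExteriorAlgebra K W)))) =
      (g + 1) * (g + 2) * (2 * g + 3) := by
  rw [hω.finrank_adjoin_lefschetzDual hg, six_mul_sum_range_succ_sq]

/-- `dim K[e_ω, *_L] = Σ_{k=0}^{g} (k + 1)²` (the same algebra, row g30-#2). [cite: Andre1996Motifs, Prop. 1.2 (p. 11)] -/
theorem IsSymplectic.finrank_adjoin_lefschetzStar (hω : IsSymplectic ω g) (hg : 0 < g) :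
    finrank K ↥(Algebra.adjoin K
      ({LinearMap.mul K (ExteriorAlgebra K W) ω, lefschetzStar ω g} : Set (Module.End K (ExteriorAlgebra K W)))) =
      ∑ k ∈ Finset.range (g + 1), (k + 1) ^ 2 := by
  rw [hω.adjoin_lefschetzStar_eq_adjoin_lefschetzDual hg, hω.finrank_adjoin_lefschetzDual hg]

/-- `dim K[e_ω, ∗] = Σ_{k=0}^{g} (k + 1)²`. [cite: Andre1996Motifs, Prop. 1.2 (p. 11)] [cite: Milne1999LefschetzClasses, §5 Thm. 5.9 (proof)] -/
theorem IsSymplectic.finrank_adjoin_hodgeStar (hω : IsSymplectic ω g) (hg : 0 < g) :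
    finrank K ↥(Algebra.adjoin K
      ({LinearMap.mul K (ExteriorAlgebra K W) ω, hodgeStar ω g} : Set (Module.End K (ExteriorAlgebra K W)))) =
      ∑ k ∈ Finset.range (g + 1), (k + 1) ^ 2 := by
  rw [hω.adjoin_hodgeStar_eq_adjoin_lefschetzDual hg, hω.finrank_adjoin_lefschetzDual hg]

/-! ## §3 André's isomorphism `(Π_{k=0}^{g} M_{k+1}(K)) ≅ K[e_ω, ᶜΛ]` and the matrices of `e_ω`, `*_L e_ω *_L`, `*_L`, `∗`, `ᶜΛ`, `h` -/

/-- **ANDRÉ'S CANONICAL ISOMORPHISM on `⋀ W`: `(Π_{k=0}^{g} M_{k+1}(K)) ≃ₐ[K] K[e_ω, ᶜΛ]`** (row g30-#5's `matrixEquiv`, reindexed by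
`stringTypes = {0, …, g}` and with `ᶜΛ` written as `lefschetzDual ω g`). [cite: Andre1996Motifs, Prop. 1.2 (p. 11)] -/
def IsSymplectic.matrixEquiv (hω : IsSymplectic ω g) (hg : 0 < g) :
    ((k : ↥(Finset.range (g + 1))) → Matrix (Fin ((k : ℕ) + 1)) (Fin ((k : ℕ) + 1)) K) ≃ₐ[K]
      ↥(Algebra.adjoin K
        ({LinearMap.mul K (ExteriorAlgebra K W) ω, lefschetzDual ω g} : Set (Module.End K (ExteriorAlgebra K W)))) := by
  haveI := hω.finiteDimensional_exteriorAlgebra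
  exact ((matrixFamilyCongr hω.stringTypes_eq).symm.trans
    (hω.hasLefschetzProperty_mul.matrixEquiv (isZGrading_shiftedDegree K (fun i : ℕ ↦ ⋀[K]^i W) g))).trans
    (Subalgebra.equivOfEq _ _ (by rw [hω.dual_eq_lefschetzDual hg]))

/-- `matrixEquiv c`, as an operator, is `Φ` of the reindexed family. [cite: Andre1996Motifs, Prop. 1.2 (p. 11)] -/
theorem IsSymplectic.coe_matrixEquiv_apply (hω : IsSymplectic ω g) (hg : 0 < g) [FiniteDimensional K (ExteriorAlgebra K W)]
    (c : (k : ↥(Finset.range (g + 1))) → Matrix (Fin ((k : ℕ) + 1)) (Fin ((k : ℕ) + 1)) K) :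
    (hω.matrixEquiv hg c : Module.End K (ExteriorAlgebra K W)) =
      hω.hasLefschetzProperty_mul.matrixHom (isZGrading_shiftedDegree K (fun i : ℕ ↦ ⋀[K]^i W) g)
        ((matrixFamilyCongr hω.stringTypes_eq).symm c) := rfl

/-- The inverse: if `Φ` of the reindexed family is `x` then `matrixEquiv⁻¹ x = c`. [cite: Andre1996Motifs, Prop. 1.2 (p. 11)] -/
theorem IsSymplectic.matrixEquiv_symm_apply_eq (hω : IsSymplectic ω g) (hg : 0 < g)
    {c : (k : ↥(Finset.range (g + 1))) → Matrix (Fin ((k : ℕ) + 1)) (Fin ((k : ℕ) + 1)) K}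
    {x : ↥(Algebra.adjoin K
      ({LinearMap.mul K (ExteriorAlgebra K W) ω, lefschetzDual ω g} : Set (Module.End K (ExteriorAlgebra K W))))}
    (hc : (hω.matrixEquiv hg c : Module.End K (ExteriorAlgebra K W)) = x) : (hω.matrixEquiv hg).symm x = c := by
  rw [AlgEquiv.symm_apply_eq]
  exact Subtype.ext hc.symm

/-- **"l'image de `L` […] `m_{ij} = 1` si `i = j + 1`": `matrixEquiv(sub-diagonal) = e_ω`.** [cite: Andre1996Motifs, Prop. 1.2 (p. 12, proof)] -/
theorem IsSymplectic.coe_matrixEquiv_subdiag (hω : IsSymplectic ω g) (hg : 0 < g) :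
    (hω.matrixEquiv hg (fun _ a b ↦ if (a : ℕ) = (b : ℕ) + 1 then 1 else 0) : Module.End K (ExteriorAlgebra K W)) =
      LinearMap.mul K (ExteriorAlgebra K W) ω := by
  haveI := hω.finiteDimensional_exteriorAlgebra
  rw [hω.coe_matrixEquiv_apply hg]
  exact hω.hasLefschetzProperty_mul.matrixHom_subdiag _

/-- **"… resp. `*_L L *_L` […] `i = j - 1`": `matrixEquiv(super-diagonal) = *_L e_ω *_L`** (Milne's `Λ`).
[cite: Andre1996Motifs, Prop. 1.2 (p. 12, proof)] [cite: Milne1999LefschetzClasses, §5 p. 664] -/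
theorem IsSymplectic.coe_matrixEquiv_superdiag (hω : IsSymplectic ω g) (hg : 0 < g) :
    (hω.matrixEquiv hg (fun _ a b ↦ if (b : ℕ) = (a : ℕ) + 1 then 1 else 0) : Module.End K (ExteriorAlgebra K W)) =
      lefschetzStar ω g * LinearMap.mul K (ExteriorAlgebra K W) ω * lefschetzStar ω g := by
  haveI := hω.finiteDimensional_exteriorAlgebra
  rw [hω.coe_matrixEquiv_apply hg, hω.lefschetzStar_eq]
  exact hω.hasLefschetzProperty_mul.matrixHom_superdiag _

/-- `matrixEquiv(anti-diagonal) = *_L`. [cite: Andre1996Motifs, Prop. 1.2 (pp. 11–12)] -/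
theorem IsSymplectic.coe_matrixEquiv_antidiag (hω : IsSymplectic ω g) (hg : 0 < g) :
    (hω.matrixEquiv hg (fun k a b ↦ if (a : ℕ) + (b : ℕ) = (k : ℕ) then 1 else 0) : Module.End K (ExteriorAlgebra K W)) =
      lefschetzStar ω g := by
  haveI := hω.finiteDimensional_exteriorAlgebra
  rw [hω.coe_matrixEquiv_apply hg, hω.lefschetzStar_eq]
  exact hω.hasLefschetzProperty_mul.matrixHom_antidiag _

/-- `matrixEquiv(ε_k · anti-diagonal) = ∗`, `ε_k = (-1)^{(g-k)(g-k+1)/2}`. [cite: Andre1996Motifs, Prop. 1.2 (pp. 11–12)]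
[cite: Milne1999LefschetzClasses, §5 p. 664 (∗)] -/
theorem IsSymplectic.coe_matrixEquiv_antidiag_smul (hω : IsSymplectic ω g) (hg : 0 < g) :
    (hω.matrixEquiv hg (fun k a b ↦ if (a : ℕ) + (b : ℕ) = (k : ℕ) then (-1 : K) ^ ((g - k) * (g - k + 1) / 2) else 0) :
      Module.End K (ExteriorAlgebra K W)) = hodgeStar ω g := by
  haveI := hω.finiteDimensional_exteriorAlgebra
  rw [hω.coe_matrixEquiv_apply hg, hω.hodgeStar_eq]
  exact hω.hasLefschetzProperty_mul.matrixHom_antidiag_smul _ g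

/-- `matrixEquiv((a+1)(k-a) on the super-diagonal) = ᶜΛ`. [cite: Andre1996Motifs, §1.1 (formula for ᶜΛ), Prop. 1.2 (pp. 11–12)] -/
theorem IsSymplectic.coe_matrixEquiv_dualMatrix (hω : IsSymplectic ω g) (hg : 0 < g) :
    (hω.matrixEquiv hg (fun k a b ↦ if (b : ℕ) = (a : ℕ) + 1 then ((a : K) + 1) * ((k : ℕ) - (a : K)) else 0) :
      Module.End K (ExteriorAlgebra K W)) = lefschetzDual ω g := by
  haveI := hω.finiteDimensional_exteriorAlgebra
  rw [hω.coe_matrixEquiv_apply hg, ← hω.dual_eq_lefschetzDual hg]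
  exact hω.hasLefschetzProperty_mul.matrixHom_dualMatrix _

/-- `matrixEquiv(diag(2a - k)) = h` (the shifted degree). [cite: Andre1996Motifs, Prop. 1.2 (pp. 11–12)] -/
theorem IsSymplectic.coe_matrixEquiv_diag (hω : IsSymplectic ω g) (hg : 0 < g) :
    (hω.matrixEquiv hg (fun k a b ↦ if a = b then 2 * (a : K) - (k : ℕ) else 0) : Module.End K (ExteriorAlgebra K W)) =
      shiftedDegree K (fun i : ℕ ↦ ⋀[K]^i W) g := by
  haveI := hω.finiteDimensional_exteriorAlgebra
  rw [hω.coe_matrixEquiv_apply hg]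
  exact hω.hasLefschetzProperty_mul.matrixHom_diag _

/-! ## §4 André's Remark on `⋀ W`: two symplectic spaces of the same genus have isomorphic `K[e_ω, ᶜΛ]`, `e_ω ↦ e_ω'`, `*_L ↦ *_L'` -/

section Comparison

variable {W' : Type v'} [AddCommGroup W'] [Module K W'] {ω' : ExteriorAlgebra K W'}

/-- **ANDRÉ'S COMPARISON ISOMORPHISM on exterior algebras: `K[e_ω, ᶜΛ] ≃ₐ[K] K[e_ω', ᶜΛ']`** for non-degenerate 2-vectors of the
same genus `g` (same Betti numbers `binom(2g, j)`). [cite: Andre1996Motifs, Remark after Prop. 1.2 (p. 12)] -/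
def IsSymplectic.kleimanAlgebraCongr (hω : IsSymplectic ω g) (hω' : IsSymplectic ω' g) (hg : 0 < g) :
    ↥(Algebra.adjoin K ({LinearMap.mul K (ExteriorAlgebra K W) ω, lefschetzDual ω g} : Set (Module.End K (ExteriorAlgebra K W)))) ≃ₐ[K]
      ↥(Algebra.adjoin K
        ({LinearMap.mul K (ExteriorAlgebra K W') ω', lefschetzDual ω' g} : Set (Module.End K (ExteriorAlgebra K W')))) :=
  (hω.matrixEquiv hg).symm.trans (hω'.matrixEquiv hg)

/-- **"`L ↦ L'`": `e_ω ↦ e_ω'`.** [cite: Andre1996Motifs, Remark after Prop. 1.2 (p. 12)] -/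
theorem IsSymplectic.coe_kleimanAlgebraCongr_mul (hω : IsSymplectic ω g) (hω' : IsSymplectic ω' g) (hg : 0 < g) :
    (hω.kleimanAlgebraCongr hω' hg ⟨LinearMap.mul K (ExteriorAlgebra K W) ω, Algebra.subset_adjoin (Set.mem_insert _ _)⟩ :
      Module.End K (ExteriorAlgebra K W')) = LinearMap.mul K (ExteriorAlgebra K W') ω' := by
  rw [IsSymplectic.kleimanAlgebraCongr, AlgEquiv.trans_apply, hω.matrixEquiv_symm_apply_eq hg (hω.coe_matrixEquiv_subdiag hg)]
  exact hω'.coe_matrixEquiv_subdiag hg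

/-- **"`*_L ↦ *_{L'}`".** [cite: Andre1996Motifs, Remark after Prop. 1.2 (p. 12)] -/
theorem IsSymplectic.coe_kleimanAlgebraCongr_lefschetzStar (hω : IsSymplectic ω g) (hω' : IsSymplectic ω' g) (hg : 0 < g) :
    (hω.kleimanAlgebraCongr hω' hg ⟨lefschetzStar ω g, hω.lefschetzStar_mem_adjoin_lefschetzDual hg⟩ :
      Module.End K (ExteriorAlgebra K W')) = lefschetzStar ω' g := by
  rw [IsSymplectic.kleimanAlgebraCongr, AlgEquiv.trans_apply, hω.matrixEquiv_symm_apply_eq hg (hω.coe_matrixEquiv_antidiag hg)]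
  exact hω'.coe_matrixEquiv_antidiag hg

/-- `∗ ↦ ∗'`. [cite: Andre1996Motifs, Remark after Prop. 1.2 (p. 12)] [cite: Milne1999LefschetzClasses, §5 p. 664] -/
theorem IsSymplectic.coe_kleimanAlgebraCongr_hodgeStar (hω : IsSymplectic ω g) (hω' : IsSymplectic ω' g) (hg : 0 < g) :
    (hω.kleimanAlgebraCongr hω' hg ⟨hodgeStar ω g, hω.hodgeStar_mem_adjoin_lefschetzDual hg⟩ :
      Module.End K (ExteriorAlgebra K W')) = hodgeStar ω' g := by
  rw [IsSymplectic.kleimanAlgebraCongr, AlgEquiv.trans_apply, hω.matrixEquiv_symm_apply_eq hg (hω.coe_matrixEquiv_antidiag_smul hg)]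
  exact hω'.coe_matrixEquiv_antidiag_smul hg

/-- `ᶜΛ ↦ ᶜΛ'`. [cite: Andre1996Motifs, Remark after Prop. 1.2 (p. 12)] -/
theorem IsSymplectic.coe_kleimanAlgebraCongr_lefschetzDual (hω : IsSymplectic ω g) (hω' : IsSymplectic ω' g) (hg : 0 < g) :
    (hω.kleimanAlgebraCongr hω' hg ⟨lefschetzDual ω g, Algebra.subset_adjoin (Set.mem_insert_of_mem _ rfl)⟩ :
      Module.End K (ExteriorAlgebra K W')) = lefschetzDual ω' g := by
  rw [IsSymplectic.kleimanAlgebraCongr, AlgEquiv.trans_apply, hω.matrixEquiv_symm_apply_eq hg (hω.coe_matrixEquiv_dualMatrix hg)]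
  exact hω'.coe_matrixEquiv_dualMatrix hg

/-- `h ↦ h'` (the shifted degrees). [cite: Andre1996Motifs, Remark after Prop. 1.2 (p. 12)] -/
theorem IsSymplectic.coe_kleimanAlgebraCongr_shiftedDegree (hω : IsSymplectic ω g) (hω' : IsSymplectic ω' g) (hg : 0 < g) :
    (hω.kleimanAlgebraCongr hω' hg ⟨shiftedDegree K (fun i : ℕ ↦ ⋀[K]^i W) g, hω.shiftedDegree_mem_adjoin_lefschetzDual hg⟩ :
      Module.End K (ExteriorAlgebra K W')) = shiftedDegree K (fun i : ℕ ↦ ⋀[K]^i W') g := by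
  rw [IsSymplectic.kleimanAlgebraCongr, AlgEquiv.trans_apply, hω.matrixEquiv_symm_apply_eq hg (hω.coe_matrixEquiv_diag hg)]
  exact hω'.coe_matrixEquiv_diag hg

end Comparison

end Literature.AlgebraicGeometry.Motives.ExteriorLefschetz

end
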